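import Literature.NumberTheory.Automorphic.TotallyRealModularityQuarticSixteenCurves

/-!
# Route `SqrtFiveQuarticCovers`, crux `ReductionToRefinedLocus` (stmt-Langlands-17834), line `birth`:
# the registered stub `stub_boxThreeSeven` modulo its printed sources

The stub `stub_boxThreeSeven` of `Cruxes/ReductionToRefinedLocus/Lines/birth.lean` is Box 2022,
Thm. 1.3 (i) and (iii) over a totally real QUARTIC field, in the route's written-out rendering: for
`E / 𝓞 K` (`Δ ≠ 0`) not modular in the trace-only sense, some framing of `E[3]` is Borel or lands
in `C_s⁺(3) = ⟨diag(1,2), antidiag(1,1)⟩`, and some framing of `E[7]` is Borel or lands in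
`G(e7) = ⟨(0 5;3 0), (5 0;3 2)⟩`.

Two kernel-checked routes to EXACTLY the registered signature (as the conclusion):
* `stub_boxThreeSeven_of_Box2022_theorem1_3` — from the single named fact `Box2022_theorem1_3`
  (Box 2022, Thm. 1.3), through the tree's
  `Box2022_theorem1_3.quartic_of_not_isModularEllipticCurve` (definitional unfolding only);
* `stub_boxThreeSeven_of_liftingTheorems` — from the three printed LIFTING theorems behind Box's
  Thm. 1.3 / Thm. 7.1 (`FLS2015_theorem3`, `FLS2015_theorem4`, `Kalyanswamy2018_theorem1_2`),
  through the tree's PROVED `Box2022.theorem7_1_of_not_isModularEllipticCurve` (its coarse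
  `5`-clause is discarded) — the same three inputs as the crux-level
  `GroupCensusFive.reductionToRefinedLocus_of_liftingTheorems`.

HONEST STATUS: CONDITIONAL (named-fact hypotheses; modularity lifting has no carrier in the tree);
neither theorem closes the stub by name — the registered stub, hypothesis-free, IS the printed
theorem.  Helper of stmt-Langlands-17834 (`--supports`); proves modularity of nothing.

References: [Box2022] J. Box, *Elliptic curves over totally real quartic fields not containing √5
are modular*, Trans. AMS 375 (2022), Thms. 1.3, 7.1; [FreitasLeHungSiksek2015] Thms. 3–4;
[Kalyanswamy2018] Thm. 1.2.
-/

set_option linter.dupNamespace false -- project-wide option; `Summit.Langlands.Langlands` is the mandated namespace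

namespace Summit.Langlands.Langlands.Theorems.SqrtFiveQuarticCovers

open scoped NumberField Matrix
open Literature.NumberTheory.Automorphic Literature.NumberTheory.GaloisRepresentations

/-- **Registered stub `stub_boxThreeSeven` (line `birth`, stmt-Langlands-17834) modulo Box 2022,
Thm. 1.3.**  Assuming `Box2022_theorem1_3`: over a totally real quartic `K`, a curve `E / 𝓞 K`
(`Δ ≠ 0`) that is not modular in the trace-only sense has a framing of `E[3]` that is Borel or in
`C_s⁺(3)` and a framing of `E[7]` that is Borel or in `G(e7)`.  The conclusion is the registered
stub signature verbatim (the route's definitions unfolded; `Iff.rfl` with the Literature form).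
[cite: Box2022, Thm. 1.3 (i), (iii)] -/
theorem stub_boxThreeSeven_of_Box2022_theorem1_3 (h : Box2022_theorem1_3) :
    ∀ (K : Type) [Field K] [NumberField K], NumberField.IsTotallyReal K → Module.finrank ℚ K = 4 → ∀ E : WeierstrassCurve (NumberField.RingOfIntegers K), E.Δ ≠ 0 → ¬ ((E.baseChange K).HasCM ∨ ∃ (hF : Literature.NumberTheory.Automorphic.isCompact_glFiniteIntegralLevel 2 K) (π : Literature.NumberTheory.Automorphic.CuspidalAutomorphicRepData 2 K hF), π.1.HasWeightZero ∧ ∀ᶠ w : IsDedekindDomain.HeightOneSpectrum (NumberField.RingOfIntegers K) in Filter.cofinite, ∃ α : Multiset ℂ, π.1.HasSatakeParamAt w α ∧ ((Real.sqrt w.residueCard : ℝ) : ℂ) * α.sum = (Literature.NumberTheory.Automorphic.frobTraceAt E w : ℂ)) → (∃ ρ : Literature.NumberTheory.GaloisRepresentations.FramedGaloisRep K (ZMod 3) 2, (∃ e : (E.baseChange K).geomTorsion ((3 : ℕ) : ℤ) ≃+ (Fin 2 → ZMod 3), ∀ (σ : Field.absoluteGaloisGroup K) (P : (E.baseChange K).geomTorsion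 ((3 : ℕ) : ℤ)), e (σ • P) = ((ρ σ : GL (Fin 2) (ZMod 3)) : Matrix (Fin 2) (Fin 2) (ZMod 3)) *ᵥ (e P)) ∧ ((∀ σ : Field.absoluteGaloisGroup K, (((ρ σ : GL (Fin 2) (ZMod 3)) : Matrix (Fin 2) (Fin 2) (ZMod 3)) 1 0 = 0)) ∨ (∀ σ : Field.absoluteGaloisGroup K, (ρ σ : GL (Fin 2) (ZMod 3)) ∈ Subgroup.closure ({(⟨!![1, 0; 0, 2], !![1, 0; 0, 2], by decide, by decide⟩ : GL (Fin 2) (ZMod 3)), (⟨!![0, 1; 1, 0], !![0, 1; 1, 0], by decide, by decide⟩ : GL (Fin 2) (ZMod 3))} : Set (GL (Fin 2) (ZMod 3)))))) ∧ (∃ ρ : Literature.NumberTheory.GaloisRepresentations.FramedGaloisRep K (ZMod 7) 2, (∃ e : (E.baseChange K).geomTorsion ((7 : ℕ) : ℤ) ≃+ (Fin 2 → ZMod 7), ∀ (σ : Field.absoluteGaloisGroup K) (P : (E.baseChange K).geomTorsion ((7 : ℕ) : ℤ)), e (σ • P) = ((ρ σ : GL (Fin 2) (ZMod 7)) : Matrix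 (Fin 2) (Fin 2) (ZMod 7)) *ᵥ (e P)) ∧ ((∀ σ : Field.absoluteGaloisGroup K, (((ρ σ : GL (Fin 2) (ZMod 7)) : Matrix (Fin 2) (Fin 2) (ZMod 7)) 1 0 = 0)) ∨ (∀ σ : Field.absoluteGaloisGroup K, (ρ σ : GL (Fin 2) (ZMod 7)) ∈ Subgroup.closure ({(⟨!![0, 5; 3, 0], !![0, 5; 3, 0], by decide, by decide⟩ : GL (Fin 2) (ZMod 7)), (⟨!![5, 0; 3, 2], !![3, 0; 6, 4], by decide, by decide⟩ : GL (Fin 2) (ZMod 7))} : Set (GL (Fin 2) (ZMod 7)))))) := by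
  intro K _ _ hK hd E hΔ hne
  exact Box2022_theorem1_3.quartic_of_not_isModularEllipticCurve h K hK hd E hΔ hne

/-- **Registered stub `stub_boxThreeSeven` modulo the three printed lifting theorems**
`FLS2015_theorem3`, `FLS2015_theorem4`, `Kalyanswamy2018_theorem1_2` (the inputs of Box 2022,
Thm. 7.1, which the tree PROVES from them as `Box2022.theorem7_1`): the `3`- and `7`-clauses of
that theorem are the stub; its `5`-clause is dropped.  Conclusion = the registered signature
verbatim. [cite: Box2022, Thm. 7.1] -/
theorem stub_boxThreeSeven_of_liftingTheorems (h3 : FLS2015_theorem3) (h4 : FLS2015_theorem4)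
    (hKal : Kalyanswamy2018_theorem1_2) :
    ∀ (K : Type) [Field K] [NumberField K], NumberField.IsTotallyReal K → Module.finrank ℚ K = 4 → ∀ E : WeierstrassCurve (NumberField.RingOfIntegers K), E.Δ ≠ 0 → ¬ ((E.baseChange K).HasCM ∨ ∃ (hF : Literature.NumberTheory.Automorphic.isCompact_glFiniteIntegralLevel 2 K) (π : Literature.NumberTheory.Automorphic.CuspidalAutomorphicRepData 2 K hF), π.1.HasWeightZero ∧ ∀ᶠ w : IsDedekindDomain.HeightOneSpectrum (NumberField.RingOfIntegers K) in Filter.cofinite, ∃ α : Multiset ℂ, π.1.HasSatakeParamAt w α ∧ ((Real.sqrt w.residueCard : ℝ) : ℂ) * α.sum = (Literature.NumberTheory.Automorphic.frobTraceAt E w : ℂ)) → (∃ ρ : Literature.NumberTheory.GaloisRepresentations.FramedGaloisRep K (ZMod 3) 2, (∃ e : (E.baseChange K).geomTorsion ((3 : ℕ) : ℤ) ≃+ (Fin 2 → ZMod 3), ∀ (σ : Field.absoluteGaloisGroup K) (P : (E.baseChange K).geomTorsion ((3 : ℕ) : ℤ)), e (σ • P) = ((ρ σ : GL (Fin 2)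 (ZMod 3)) : Matrix (Fin 2) (Fin 2) (ZMod 3)) *ᵥ (e P)) ∧ ((∀ σ : Field.absoluteGaloisGroup K, (((ρ σ : GL (Fin 2) (ZMod 3)) : Matrix (Fin 2) (Fin 2) (ZMod 3)) 1 0 = 0)) ∨ (∀ σ : Field.absoluteGaloisGroup K, (ρ σ : GL (Fin 2) (ZMod 3)) ∈ Subgroup.closure ({(⟨!![1, 0; 0, 2], !![1, 0; 0, 2], by decide, by decide⟩ : GL (Fin 2) (ZMod 3)), (⟨!![0, 1; 1, 0], !![0, 1; 1, 0], by decide, by decide⟩ : GL (Fin 2) (ZMod 3))} : Set (GL (Fin 2) (ZMod 3)))))) ∧ (∃ ρ : Literature.NumberTheory.GaloisRepresentations.FramedGaloisRep K (ZMod 7) 2, (∃ e : (E.baseChange K).geomTorsion ((7 : ℕ) : ℤ) ≃+ (Fin 2 → ZMod 7), ∀ (σ : Field.absoluteGaloisGroup K) (P : (E.baseChange K).geomTorsion ((7 : ℕ) : ℤ)), e (σ • P) = ((ρ σ : GL (Fin 2) (ZMod 7)) : Matrix (Fin 2) (Fin 2) (ZMod 7)) *ᵥ (e P)) ∧ ((∀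 σ : Field.absoluteGaloisGroup K, (((ρ σ : GL (Fin 2) (ZMod 7)) : Matrix (Fin 2) (Fin 2) (ZMod 7)) 1 0 = 0)) ∨ (∀ σ : Field.absoluteGaloisGroup K, (ρ σ : GL (Fin 2) (ZMod 7)) ∈ Subgroup.closure ({(⟨!![0, 5; 3, 0], !![0, 5; 3, 0], by decide, by decide⟩ : GL (Fin 2) (ZMod 7)), (⟨!![5, 0; 3, 2], !![3, 0; 6, 4], by decide, by decide⟩ : GL (Fin 2) (ZMod 7))} : Set (GL (Fin 2) (ZMod 7)))))) := by
  intro K _ _ hK hd E hΔ hne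
  obtain ⟨h3c, -, h7c⟩ :=
    Box2022.theorem7_1_of_not_isModularEllipticCurve h3 h4 hKal K hK hd E hΔ hne
  exact ⟨h3c, h7c⟩

end Summit.Langlands.Langlands.Theorems.SqrtFiveQuarticCovers
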